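import Summits.ABC.StewartYu.PadicG3KStep
import HarnessLib

/-!
# Cell abc-stewartyu, crux `Y07Odd` (stmt-ABC-19658), line `gen3-slab-odd`: the extrapolation step from the ODD nodes `|x| ≤ 2N − 1`
# (Nesterenko's `𝒳_{s,0}`, the input of each new level after the Kummer half-step)

`Summits/ABC/StewartYu/PadicG3KStepOddNodes.lean` — variant of `PadicG3KStep.norm_g3F_le_of_zeros` (cell `abc-stewartyu`, seat p2-g4, F-odd lead):
same proof with the node set `{x odd, |x| ≤ 2N−1}` (`2N` nodes `2i+1−2N`), whose differences are the even integers `2(i−i′)`; since `p` is odd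
the `p`-adic conditioning is unchanged (`p^j ∣ 2(i−i′) ⇔ p^j ∣ i−i′`).  Gain `(m+½)log p` per zero, `2N·t` zeros.

WHAT THIS IS NOT: no Liouville step (compose with `PadicG3ValuesGen.g3φ_eq_zero_of_norm_lt` exactly as in `g3_kstep_pt`); no crux moves.

References: Yu. V. Nesterenko, LNM 1819 (2003) §4 (the sets `𝒳_{s,0}`); K. Yu, Compositio 74 (1990) §3; M. Waldschmidt, Acta Arith. 37 (1980) L.3.5.
-/

noncomputable section

open NormedSpace Finset IsUltrametricDist Polynomial Metric Filter
open Literature.NumberTheory.Transcendental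
open Literature.NumberTheory.Transcendental.PadicCW77 (nodeSeq length_nodeSeq mem_nodeSeq count_nodeSeq
  countP_nodeSeq card_filter_range_mod_le condExp)
open Literature.NumberTheory.Transcendental.CW77.Setup (Tau tauNorm)
open scoped Nat Topology

namespace Summit.ABC.StewartYu

namespace G3Setup

variable {p : ℕ} [Fact p.Prime] (S : G3Setup p) {ι : Type*} (R : ι → ℚ[X]) (v : ι → Fin S.n → ℤ)

/-- **The `p`-adic extrapolation bound from zeros at the ODD nodes** (the input of level `s+1`, Nesterenko's `𝒳_{s,0}`).  On a twist class
with relative depth-`m+1` exponents: if `g3φ τ'' x = 0` for all ODD integers `|x| ≤ 2N − 1` and all `|τ''| < Tlo`, the `Y₀`-weights satisfy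
`‖coeffₖ(hw i t₀)‖·(p^m√p)ᵏ ≤ Bw` and `‖Λ/b_{j₀}‖ ≤ p⁻¹`, then for `‖z‖ ≤ 1` and `|τ| + t ≤ Tlo` (`t ≥ 1`):
`‖f_τ(z)‖, ‖φ_τ(z)‖ ≤ max (Bw·‖Λ/b_{j₀}‖·p^{⌊(t−1)/2⌋}·p^{condExp p (2N) t}) (Bw / (p^m√p)^{2N·t})` (`2N` odd nodes; `p` odd, so the
`p`-adic distances of odd integers are those of their half-differences). [cite: Nesterenko2003, §4.3 (𝒳_{s,0})] [cite: Yu1990, §3] -/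
theorem norm_g3F_le_of_zeros_oddNodes (m : ℕ) (B : Finset ι) (hB : ∀ i ∈ B, ‖S.E (v i)‖ ≤ (p : ℝ)⁻¹ ^ (m + 1))
    (hcls : ∀ i ∈ B, S.cls (v i) = 1) (pv : ι → ℤ) {N Tlo t : ℕ} (ht : 1 ≤ t)
    {Bw : ℝ} (hBw0 : 0 ≤ Bw) (hBw : ∀ i ∈ B, ∀ t₀ k, ‖(hw (p := p) R i t₀).coeff k‖ * ((p : ℝ) ^ m * Real.sqrt p) ^ k ≤ Bw)
    (hΛ : ‖S.Λ / (S.b S.j₀ : ℚ_[p])‖ ≤ (p : ℝ)⁻¹)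
    (hzero : ∀ x : ℤ, Odd x → |x| ≤ (2 * N - 1 : ℤ) → ∀ τ'' : Tau S.n, tauNorm τ'' < Tlo → S.g3φ R v B pv τ'' x = 0)
    {z : ℚ_[p]} (hz : ‖z‖ ≤ 1) (τ : Tau S.n) (hτ : tauNorm τ + t ≤ Tlo) :
    ‖S.g3F R v B pv τ z‖ ≤
        max (Bw * ‖S.Λ / (S.b S.j₀ : ℚ_[p])‖ * (p : ℝ) ^ ((t - 1) / 2) * (p : ℝ) ^ condExp p (2 * N) t)
          (Bw / ((p : ℝ) ^ m * Real.sqrt p) ^ ((2 * N) * t)) ∧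
      ‖S.g3Φ R v B pv τ z‖ ≤
        max (Bw * ‖S.Λ / (S.b S.j₀ : ℚ_[p])‖ * (p : ℝ) ^ ((t - 1) / 2) * (p : ℝ) ^ condExp p (2 * N) t)
          (Bw / ((p : ℝ) ^ m * Real.sqrt p) ^ ((2 * N) * t)) := by
  classical
  have hTlo : 1 ≤ Tlo := by omega
  have hprime : p.Prime := Fact.out
  have hp2 : p ≠ 2 := by have := S.hp3; omega
  have hp0 : (0 : ℝ) < p := S.p_pos
  have h1p : (1 : ℝ) ≤ p := S.one_lt_p.le
  set kpts : ℕ := 2 * N with hkpts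
  set Pt : ℝ := (p : ℝ) ^ ((t - 1) / 2) with hPt
  set ρ : ℝ := (p : ℝ) ^ m * Real.sqrt p with hρdef
  have hρ : 0 < ρ := mul_pos (pow_pos hp0 m) S.sqrt_p_pos
  have h1ρ : (1 : ℝ) < ρ := by
    have hs : 1 < Real.sqrt p := by
      rw [show (1 : ℝ) = Real.sqrt 1 by simp]
      exact Real.sqrt_lt_sqrt zero_le_one S.one_lt_p
    calc (1 : ℝ) = 1 * 1 := (mul_one 1).symm
      _ < ρ := mul_lt_mul' (one_le_pow₀ h1p) hs zero_le_one (pow_pos hp0 m)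
  set δ : ℝ := ‖S.Λ / (S.b S.j₀ : ℚ_[p])‖ with hδ
  have hδ0 : 0 ≤ δ := norm_nonneg _
  -- (a) the `f − φ` comparison on the unit disc with `Q := Bw`
  have hQ : ∀ (τ' : Tau S.n) (z : ℚ_[p]), ‖z‖ ≤ 1 → ∀ i ∈ B, ‖(hw (p := p) R i τ'.1).eval z‖ ≤ Bw :=
    fun τ' z hz i hi => S.norm_hw_eval_le_of_wt R m i τ'.1 hBw0 (hBw i hi τ'.1) hz
  have hFΦ : ∀ (τ' : Tau S.n) (z : ℚ_[p]), ‖z‖ ≤ 1 →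
      ‖S.g3F R v B pv τ' z - S.g3Φ R v B pv τ' z‖ ≤ Bw * δ := fun τ' z hz =>
    S.norm_g3F_sub_g3Φ_le R v B pv τ' hz hΛ hBw0 (hQ τ' z hz)
  -- integers lie in the unit disc
  have hint : ∀ x : ℤ, ‖(x : ℚ_[p])‖ ≤ 1 := fun x => Padic.norm_int_le_one (p := p) x
  -- the odd nodes `node i = 2i + 1 − 2N`, `i < 2N`
  set node : ℕ → ℚ_[p] := fun i => ((2 * (i : ℤ) + 1 - 2 * N : ℤ) : ℚ_[p]) with hnode
  have hnodeZ : ∀ i < kpts, Odd (2 * (i : ℤ) + 1 - 2 * N) ∧ |(2 * (i : ℤ) + 1 - 2 * N)| ≤ (2 * N - 1 : ℤ) := by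
    intro i hi
    refine ⟨⟨(i : ℤ) - N, by ring⟩, ?_⟩
    rw [abs_le]; constructor <;> omega
  -- (b) values at the nodes
  have hval : ∀ i < kpts, ∀ τ' : Tau S.n, tauNorm τ' ≤ Tlo - 1 → ‖S.g3F R v B pv τ' (node i)‖ ≤ Bw * δ := by
    intro i hi τ' hτ'
    have h0 : S.g3Φ R v B pv τ' (node i) = 0 := by
      simp only [hnode]
      rw [S.g3Φ_intCast R v B hcls, hzero _ (hnodeZ i hi).1 (hnodeZ i hi).2 τ' (by omega), Rat.cast_zero]
    have := hFΦ τ' (node i) (by simp only [hnode]; exact hint _)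
    rwa [h0, sub_zero] at this
  -- the coefficient sequence and its weighted bound
  set b : ℕ → ℚ_[p] := S.coeffG3F R v B pv τ with hb
  have hbB : PadicNewton.WtBdd ρ Bw b := S.wtBdd_coeffG3F R v m B hB pv τ hBw0 (fun i hi k => hBw i hi τ.1 k)
  -- the node set
  set nodes : Finset ℚ_[p] := (range kpts).image node with hnodes
  have hmem : ∀ a ∈ nodes, ∃ i < kpts, a = node i := by
    intro a ha
    obtain ⟨i, hi, rfl⟩ := mem_image.mp ha
    exact ⟨i, mem_range.mp hi, rfl⟩
  have hnod : ∀ a ∈ nodes, ‖a‖ ≤ 1 := by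
    intro a ha; obtain ⟨i, -, rfl⟩ := hmem a ha; simp only [hnode]; exact hint _
  -- differences of nodes are the EVEN integers `2(i − i')`
  have hdiff : ∀ i i' : ℕ, node i - node i' = ((2 * ((i : ℤ) - i') : ℤ) : ℚ_[p]) := by
    intro i i'; simp only [hnode]; push_cast; ring
  -- the level structure: radii `R0 j = p^{-j}`, levels `Rl j = R0 (min j Jm)`, `Jm = ⌊log_p kpts⌋`
  set R0 : ℕ → ℝ := fun j => ((p : ℝ)⁻¹) ^ j with hR0def
  have hR0pos : ∀ j, 0 < R0 j := fun j => by simp only [hR0def]; positivity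
  have hR0anti : ∀ a b, a ≤ b → R0 b ≤ R0 a := fun a b hab => by
    simp only [hR0def]
    exact pow_le_pow_of_le_one (by positivity) (inv_le_one_of_one_le₀ h1p) hab
  have hR0ratio : ∀ j, R0 j / R0 (j + 1) = p := by
    intro j; simp only [hR0def, pow_succ]; field_simp
  have hR0zpow : ∀ j : ℕ, R0 j = (p : ℝ) ^ (-(j : ℤ)) := fun j => by
    simp only [hR0def, zpow_neg, zpow_natCast, inv_pow]
  set Jm : ℕ := Nat.log p (2 * kpts) with hJm
  set Rl : ℕ → ℝ := fun j => R0 (min j Jm) with hRl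
  have hRl0 : Rl 0 = 1 := by simp [hRl, hR0def]
  have hRlpos : ∀ j, 0 < Rl j := fun j => hR0pos _
  have hRlanti : ∀ j, Rl (j + 1) ≤ Rl j := fun j => hR0anti _ _ (min_le_min (Nat.le_succ j) le_rfl)
  have hlev : ∀ a ∈ nodes, ∀ a' ∈ nodes, a ≠ a' → ∃ j < Jm + 1, ‖a - a'‖ = Rl j := by
    intro a ha a' ha' hne
    obtain ⟨i, hi, rfl⟩ := hmem a ha
    obtain ⟨i', hi', rfl⟩ := hmem a' ha'
    set mm : ℤ := 2 * ((i : ℤ) - i') with hmm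
    have hm0 : mm ≠ 0 := by
      intro h0; apply hne
      have : (i : ℤ) = i' := by omega
      have : i = i' := by exact_mod_cast this
      simp only [hnode, this]
    have hmabs : mm.natAbs ≤ 2 * kpts := by omega
    have hdvd : p ^ padicValInt p mm ∣ mm.natAbs := by
      have h1 := Int.natAbs_dvd_natAbs.mpr (padicValInt_dvd (p := p) mm)
      simpa [Int.natAbs_pow] using h1
    have hvle : padicValInt p mm ≤ Jm := by
      have h2 : p ^ padicValInt p mm ≤ 2 * kpts := (Nat.le_of_dvd (Int.natAbs_pos.mpr hm0) hdvd).trans hmabs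
      exact Nat.le_log_of_pow_le hprime.one_lt h2
    refine ⟨padicValInt p mm, by omega, ?_⟩
    have hRv : Rl (padicValInt p mm) = R0 (padicValInt p mm) := by simp only [hRl, min_eq_left hvle]
    rw [hRv, hdiff, hR0zpow]
    have : ((mm : ℚ) : ℚ_[p]) = (mm : ℚ_[p]) := by push_cast; rfl
    rw [← this, Padic.norm_eq_zpow_neg_valuation (by exact_mod_cast hm0), Padic.valuation_ratCast,
      padicValRat.of_int]
  -- (c) the jets at the nodes (`‖1/k!‖ ≤ p^{⌊(k−1)/2⌋} ≤ Pt`)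
  set εj : ℝ := Bw * δ * Pt with hεj
  have hεj0 : 0 ≤ εj := by positivity
  have hjet : ∀ a ∈ nodes, ∀ k < t, ‖∑' n, PadicNewton.ddList (List.replicate k a) b n * a ^ n‖ ≤ εj := by
    intro a ha k hkt
    obtain ⟨i, hi, rfl⟩ := hmem a ha
    have hj := S.norm_jet_g3F_le R v m B hB pv hBw0 (by simp only [hnode]; exact hint _) (Tlo - 1)
      (by positivity) (fun τ' hτ' => hval i hi τ' hτ') k τ (fun i' hi' k' => hBw i' hi' τ.1 k') (by omega)
    change ‖PadicNewton.jet _ b k‖ ≤ εj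
    refine hj.trans ?_
    rw [hεj, mul_comm]
    refine mul_le_mul_of_nonneg_left ?_ (by positivity)
    refine (PadicExpOdd.norm_inv_natCast_factorial_padic_le (ℓ := p) hp2 k).trans (pow_le_pow_right₀ h1p ?_)
    exact Nat.div_le_div_right (by omega)
  -- the node sequence: each node `t` times
  have hcast_inj : Function.Injective node := by
    intro i i' hii'
    simp only [hnode] at hii'
    have h' : (2 * (i : ℤ) + 1 - 2 * N : ℤ) = 2 * (i' : ℤ) + 1 - 2 * N := by
      exact_mod_cast (Int.cast_injective (α := ℚ_[p]) hii')
    have : (i : ℤ) = i' := by omega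
    exact_mod_cast this
  set xs : List ℚ_[p] := nodeSeq node kpts t with hxs
  have hxs_mem : ∀ x ∈ xs, x ∈ nodes := by
    intro x hx
    obtain ⟨i, hi, rfl⟩ := mem_nodeSeq hx
    exact mem_image.mpr ⟨i, by simpa using hi, rfl⟩
  have hxs_len : xs.length = kpts * t := length_nodeSeq node kpts t
  have hxs_cnt : ∀ a ∈ nodes, xs.count a ≤ t := by
    intro a ha
    obtain ⟨i, hi, rfl⟩ := hmem a ha
    rw [hxs, count_nodeSeq hcast_inj t kpts i, if_pos hi]
  -- (c') the conditioning: nodes within `p^{-j}` of `node i₀` agree with it mod `p^j`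
  have hball : ∀ j : ℕ, 1 ≤ j → PadicNewton.ballCount nodes (R0 j) xs ≤ t * (kpts / p ^ j + 1) := by
    intro j hj
    unfold PadicNewton.ballCount
    refine Finset.sup_le fun a ha => ?_
    obtain ⟨i₀, hi₀, rfl⟩ := hmem a ha
    rw [hxs, countP_nodeSeq]
    have hsub : ∀ i ∈ range kpts, decide (‖node i - node i₀‖ ≤ R0 j) = true → i % p ^ j = i₀ % p ^ j := by
      intro i _ hdec
      have hle : ‖node i - node i₀‖ ≤ R0 j := of_decide_eq_true hdec
      rw [hdiff, hR0zpow, Padic.norm_int_le_pow_iff_dvd] at hle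
      -- `p^j ∣ 2 (i − i₀)` and `p` odd give `p^j ∣ i − i₀`
      have hcop : IsCoprime ((p : ℤ) ^ j) 2 := by
        refine IsCoprime.pow_left ?_
        rw [Int.isCoprime_iff_gcd_eq_one, Int.gcd_comm]
        have : Nat.Coprime 2 p := (Nat.coprime_primes Nat.prime_two hprime).mpr (by omega)
        simpa [Int.gcd] using this
      have hdvd : ((p : ℤ) ^ j) ∣ (i : ℤ) - i₀ := hcop.dvd_of_dvd_mul_left hle
      have hmod : i₀ ≡ i [MOD p ^ j] := Nat.modEq_iff_dvd.mpr (by push_cast; exact hdvd)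
      exact hmod.symm
    calc ∑ i ∈ range kpts, (if decide (‖node i - node i₀‖ ≤ R0 j) = true then t else 0)
        ≤ ∑ i ∈ range kpts, (if i % p ^ j = i₀ % p ^ j then t else 0) := by
          refine sum_le_sum fun i hi => ?_
          by_cases hd : decide (‖node i - node i₀‖ ≤ R0 j) = true
          · rw [if_pos hd, if_pos (hsub i hi hd)]
          · rw [if_neg hd]; positivity
      _ = t * ((range kpts).filter fun i => i % p ^ j = i₀ % p ^ j).card := by
          rw [← Finset.sum_filter]; simp [mul_comm]
      _ ≤ t * (kpts / p ^ j + 1) := Nat.mul_le_mul_left _ (card_filter_range_mod_le kpts _ _)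
  have hcond : ∏ j ∈ range (Jm + 1), (Rl j / Rl (j + 1)) ^ PadicNewton.ballCount nodes (Rl (j + 1)) xs ≤
      (p : ℝ) ^ condExp p kpts t := by
    rw [Finset.prod_range_succ]
    have hlast : Rl Jm / Rl (Jm + 1) = 1 := by
      simp only [hRl, min_eq_left (le_refl Jm), min_eq_right (Nat.le_succ Jm), div_self (hR0pos _).ne']
    rw [hlast, one_pow, mul_one]
    have hin : ∀ j ∈ range Jm, (Rl j / Rl (j + 1)) ^ PadicNewton.ballCount nodes (Rl (j + 1)) xs =
        (p : ℝ) ^ PadicNewton.ballCount nodes (R0 (j + 1)) xs := by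
      intro j hj
      have hj' : j + 1 ≤ Jm := mem_range.mp hj
      simp only [hRl, min_eq_left (Nat.le_of_succ_le hj'), min_eq_left hj', hR0ratio]
    rw [Finset.prod_congr rfl hin, Finset.prod_pow_eq_pow_sum]
    refine pow_le_pow_right₀ h1p ?_
    have hJm' : Jm ≤ Nat.log p (2 * kpts) := le_rfl
    unfold condExp
    calc ∑ j ∈ range Jm, PadicNewton.ballCount nodes (R0 (j + 1)) xs
        ≤ ∑ j ∈ range Jm, t * (kpts / p ^ (j + 1) + 1) := sum_le_sum fun j _ => hball (j + 1) (by omega)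
      _ ≤ ∑ j ∈ range (Nat.log p (2 * kpts)), t * (kpts / p ^ (j + 1) + 1) :=
          sum_le_sum_of_subset_of_nonneg
            (fun j hj => mem_range.mpr (lt_of_lt_of_le (mem_range.mp hj) hJm')) fun _ _ _ => Nat.zero_le _
  -- (d) the small-jets Schwarz lemma (level version) at `z`
  have hschwarz := PadicNewton.norm_tsum_le_max_of_small_jets_levels hρ h1ρ le_rfl hbB nodes hnod
    Rl hRl0 hRlpos hRlanti (Jm + 1) hlev hεj0 hjet xs hxs_mem hxs_cnt hz
  have hzlt : ‖z‖ < ρ := lt_of_le_of_lt hz h1ρ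
  have hF : ‖S.g3F R v B pv τ z‖ ≤
      max (εj * ∏ j ∈ range (Jm + 1), (Rl j / Rl (j + 1)) ^ PadicNewton.ballCount nodes (Rl (j + 1)) xs)
        (Bw / ρ ^ xs.length * (xs.map fun x => ‖z - x‖).prod) := by
    rw [S.g3F_eq_tsum R v m B hB pv τ hzlt]; exact hschwarz
  have hprod : (xs.map fun x => ‖z - x‖).prod ≤ 1 := by
    have h := List.prod_map_le_prod_map₀ (s := xs) (fun x => ‖z - x‖)
      (fun _ => (1 : ℝ)) (fun x _ => norm_nonneg _) (fun x hx => by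
        rw [sub_eq_add_neg]
        exact (norm_add_le_max _ _).trans (max_le hz (by rw [norm_neg]; exact hnod x (hxs_mem x hx))))
    simpa using h
  have hterm1 : εj * ∏ j ∈ range (Jm + 1), (Rl j / Rl (j + 1)) ^ PadicNewton.ballCount nodes (Rl (j + 1)) xs ≤
      Bw * δ * Pt * (p : ℝ) ^ condExp p kpts t := mul_le_mul_of_nonneg_left hcond hεj0
  have hterm2 : Bw / ρ ^ xs.length * (xs.map fun x => ‖z - x‖).prod ≤ Bw / ρ ^ (kpts * t) := by
    rw [hxs_len]
    exact mul_le_of_le_one_right (by positivity) hprod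
  have hF' : ‖S.g3F R v B pv τ z‖ ≤ max (Bw * δ * Pt * (p : ℝ) ^ condExp p kpts t) (Bw / ρ ^ (kpts * t)) :=
    hF.trans (max_le_max hterm1 hterm2)
  refine ⟨hF', ?_⟩
  have e : S.g3Φ R v B pv τ z = S.g3F R v B pv τ z + -(S.g3F R v B pv τ z - S.g3Φ R v B pv τ z) := by ring
  rw [e]
  refine (norm_add_le_max _ _).trans (max_le hF' ?_)
  rw [norm_neg]
  refine (hFΦ τ _ hz).trans (le_max_of_le_left ?_)
  have h1 : (1 : ℝ) ≤ Pt := one_le_pow₀ h1p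
  have h2 : (1 : ℝ) ≤ (p : ℝ) ^ condExp p kpts t := one_le_pow₀ h1p
  calc Bw * δ = Bw * δ * 1 * 1 := by ring
    _ ≤ Bw * δ * Pt * (p : ℝ) ^ condExp p kpts t := by gcongr

end G3Setup

end Summit.ABC.StewartYu

end
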